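import Summits.BirchSwinnertonDyer.Rank1Residual.X2.GreenbergVatsalTateKummerLocal
import HarnessLib

/-!
# Route `ByReductionTypeAtTwo`, crux `MultUpperHalfAtTwo` (item stmt-BirchSwinnertonDyer-19922), TOWER road, Greenberg LNM 1716
# §4 p. 108 «for `v ∣ p`» at a MULTIPLICATIVE place, part 1 — the Coates–Greenberg input on the Tate side: a continuous cocycle
# of `H ≤ Γ_{K_v}` with values in `Ψ(μ) ⊂ E(K̄_v)` is a Kummer coboundary UP TO `2`

HONEST FRAMING (cell `bsd-2adic`, run/shared/lean/pub/bsd-2adic/, seat `bsd-2adic-tower-1` GEN 29, HUMAN RULINGS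
D-0036 / D-0054 / D-0074): TOOL theorems only (no definition, no named fact, no `sorry`); closes nothing by itself;
nothing booked; BSD is not proved by any of this. First module of the KERNEL proof of Greenberg's local surjectivity
`𝒫_E(ℚ_v)[p^∞] ↠ (𝒫_E(ℚ_{∞,η})[p^∞])^{Γ_{ℚ_v}}` (LNM 1716 §4, proof of Lemma 4.7, p. 108: "looking at the maps `λ_v` for
`v ∣ p`") at a place of NON-SPLIT MULTIPLICATIVE reduction — the `hsurj` binder of bsd-inputs-k4-p1's Lemma-4.7 assembly
`InputsGreenbergSelmerCoinv.subsingleton_endCoinvariants_conjSelmerInfty`, which k4-p1 proved at GOOD ORDINARY `v ∣ p`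
(`InputsGreenbergLocalAtP.exists_primary_resOfLe_eq_of_forall_conjH1_eq_atP`) with the Coates–Greenberg vanishing
`H¹(ℚ_{∞,η}, Ê(𝔪̄)) = 0` as the input «`hCG`» of its core `coinvInput_of_mem_ker`. On the Tate side (`E(K̄_v) = K̄_vˣ/q^ℤ`
with the twisted action `σ•Ψ(u) = χ(σ)Ψ(σu)`, Silverman GTM 151 V.5.3) the rôle of `Ê` is played by the units and the rôle
of `Ê[p^∞]` by `Ψ(μ)`; the Coates–Greenberg input becomes Hilbert's Theorem 90, EXCEPT for the quadratic character `χ`,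
which costs a factor `2`:

* `exists_eq_coboundary_of_values_in_roots` — for a subgroup `G₁ ≤ Γ_{K_v}` on which `Ψ` is EQUIVARIANT and a map
  `d : G₁ → E(K̄_v)` with the cocycle identity, OPEN zero set and values `Ψ(ζ_τ)`, `ζ_τ` of finite order: `d = ∂P`
  (cell b2b/X2's `GreenbergVatsalTateKummerLocal.exists_point_of_values_in_roots` re-typed for `E(K̄_v)`-valued `d`;
  proof verbatim: `τ ↦ ζ_τ` is a continuous `1`-cocycle `G₁ → K̄_vˣ` by the injectivity of `Ψ` on roots of unity,
  hence `ζ_τ = τ(u)/u` by X2's continuous Hilbert 90 `ContinuousHilbert90.exists_mul_apply_eq_of_cocycle`);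
* `exists_two_nsmul_eq_coboundary_of_values_in_roots` — for ANY subgroup `H ≤ Γ_{K_v}` and such a `d : H → E(K̄_v)`:
  **`2•d = ∂P`** (the previous on `H ∩ Stab(t)`, then X2's index-`2` step `exists_two_nsmul_eq_of_vanishing_on_stabilizer`).

References: R. Greenberg, LNM 1716 (1999), §2 pp. 75–76, §4 p. 108; J.-P. Serre, *Local Fields* X §1 Prop. 2;
J. Silverman, GTM 151, V.3.1, V.5.2–V.5.3; J. Coates, R. Greenberg, Invent. math. 124 (1996) §3 (the statement replaced).
-/

set_option autoImplicit false
-- the Theorems namespace of this sub repeats the summit name by design (D-0017 nested layout: Summit.<S>.<Sub>)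
set_option linter.dupNamespace false

noncomputable section

open scoped Classical

universe u

namespace Summit.BirchSwinnertonDyer.BirchSwinnertonDyer.Theorems.MultLocSurj

open NumberField IsDedekindDomain Field Literature.NumberTheory.GaloisRepresentations
  Literature.NumberTheory.EllipticCurves IsDedekindDomain.HeightOneSpectrum
  Summit.BirchSwinnertonDyer.Rank1Residual.X2

variable {F : Type u} [Field F] [NumberField F] (W : WeierstrassCurve F)
  {v : HeightOneSpectrum (𝓞 F)}
  (Ψ : Additive (AlgebraicClosure (v.adicCompletion F))ˣ →+ localPoints W (v.adicCompletion F))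
  {q : v.adicCompletion F}
  (hker : ∀ u : (AlgebraicClosure (v.adicCompletion F))ˣ, Ψ (Additive.ofMul u) = 0 →
    ∃ a : ℤ, (u : AlgebraicClosure (v.adicCompletion F)) =
      algebraMap (v.adicCompletion F) (AlgebraicClosure (v.adicCompletion F)) q ^ a)
  (hq0 : q ≠ 0) (hq1 : Valued.v q < 1)

/-! ### Values in `Ψ(μ)` on a subgroup where `Ψ` is equivariant ⟹ a Kummer coboundary -/

include hker hq0 hq1 in
/-- **A cocycle with values in `Ψ(μ)` on a subgroup where `Ψ` is equivariant is a coboundary.** Let `G₁ ≤ Γ_{K_v}` act on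
`E(K̄_v)` compatibly with `Ψ` (`τ•Ψ(u) = Ψ(τu)`, `hΨG`), and let `d : G₁ → E(K̄_v)` satisfy `d(τ₁τ₂) = d τ₁ + τ₁ • d τ₂`, have
OPEN zero set, and take the values `d τ = Ψ(ζ_τ)` with `ζ_τ` of finite order. Then `d τ = τ•P − P` for some `P ∈ E(K̄_v)` and
all `τ ∈ G₁`: `ζ_τ` is unique (`Ψ` is injective on roots of unity, kernel `q^ℤ` with `0 < |q| < 1`), `τ ↦ ζ_τ` is a continuous
`1`-cocycle `G₁ → K̄_vˣ`, so `ζ_τ = τ(u)/u` by continuous Hilbert 90 and `P = Ψ(u)`. Port of X2's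
`GreenbergVatsalTateKummerLocal.exists_point_of_values_in_roots` to `E(K̄_v)`-valued `d`.
[cite: GreenbergLNM1716, §2 pp. 75–76] [cite: SerreLocalFields1979, Ch. X §1 Prop. 2] -/
theorem exists_eq_coboundary_of_values_in_roots (G₁ : Subgroup (absoluteGaloisGroup (v.adicCompletion F)))
    (hΨG : ∀ τ : G₁, ∀ u : (AlgebraicClosure (v.adicCompletion F))ˣ,
      (τ : absoluteGaloisGroup (v.adicCompletion F)) • Ψ (Additive.ofMul u) =
        Ψ (Additive.ofMul (Units.map
          (Field.absoluteGaloisGroup.toAlgEquiv (v.adicCompletion F) τ :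
            AlgebraicClosure (v.adicCompletion F) →* AlgebraicClosure (v.adicCompletion F)) u)))
    (d : G₁ → localPoints W (v.adicCompletion F))
    (hd : ∀ τ₁ τ₂ : G₁, d (τ₁ * τ₂) = d τ₁ + (τ₁ : absoluteGaloisGroup (v.adicCompletion F)) • d τ₂)
    (hopen : IsOpen {τ : G₁ | d τ = 0})
    (hC : ∀ τ : G₁, ∃ ζ : (AlgebraicClosure (v.adicCompletion F))ˣ, IsOfFinOrder ζ ∧ Ψ (Additive.ofMul ζ) = d τ) :
    ∃ P : localPoints W (v.adicCompletion F), ∀ τ : G₁,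
      d τ = (τ : absoluteGaloisGroup (v.adicCompletion F)) • P - P := by
  -- adapted from `Rank1Residual/X2/GreenbergVatsalTateKummerLocal.exists_point_of_values_in_roots`
  haveI : CharZero (v.adicCompletion F) :=
    charZero_of_injective_algebraMap (algebraMap F (v.adicCompletion F)).injective
  choose ζ hζfin hζ using hC
  -- the unit cocycle `c τ = ζ_τ`
  set c : G₁ → AlgebraicClosure (v.adicCompletion F) := fun τ ↦ (ζ τ : _) with hcdef
  have hc0 : ∀ τ, c τ ≠ 0 := fun τ ↦ (ζ τ).ne_zero
  -- cocycle identity from uniqueness of `ζ_τ`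
  have hcoc : ∀ τ₁ τ₂ : G₁, ζ (τ₁ * τ₂) =
      Units.map (Field.absoluteGaloisGroup.toAlgEquiv (v.adicCompletion F) τ₁ :
        AlgebraicClosure (v.adicCompletion F) →* AlgebraicClosure (v.adicCompletion F)) (ζ τ₂) *
        ζ τ₁ := by
    intro τ₁ τ₂
    refine GreenbergVatsalTateKummerLocal.eq_of_isOfFinOrder_of_map_eq W Ψ hker hq0 hq1 (hζfin _)
      (((MonoidHom.isOfFinOrder _ (hζfin τ₂))).mul (hζfin τ₁)) ?_
    rw [hζ, hd, ofMul_mul, map_add, hζ, add_comm, ← hζ τ₂, hΨG]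
  have hc : ∀ g h : G₁, c (g * h) =
      (Field.absoluteGaloisGroup.toAlgEquiv (v.adicCompletion F) g) (c h) * c g := by
    intro g h
    simp only [hcdef]
    rw [hcoc, Units.val_mul, Units.coe_map, MonoidHom.coe_coe]
  -- openness of `{c = 1} = {d = 0}`
  have hset : {τ : G₁ | c τ = 1} = {τ : G₁ | d τ = 0} := by
    ext τ
    simp only [Set.mem_setOf_eq, hcdef, Units.val_eq_one]
    constructor
    · intro h
      rw [← hζ, h, ofMul_one, map_zero]
    · intro h
      refine GreenbergVatsalTateKummerLocal.eq_one_of_isOfFinOrder_of_map_eq_zero W Ψ hker hq0 hq1 (hζfin τ) ?_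
      rw [hζ, h]
  have hopen' : IsOpen {τ : G₁ | c τ = 1} := by rw [hset]; exact hopen
  -- continuous Hilbert 90 for `Gal(K̄_v/K_v)`
  obtain ⟨β, hβ0, hβ⟩ := ContinuousHilbert90.exists_mul_apply_eq_of_cocycle
    (k := v.adicCompletion F) (K := AlgebraicClosure (v.adicCompletion F)) G₁ c hc0 hc hopen'
  -- `u = β⁻¹`, `P = Ψ(u)`
  set u : (AlgebraicClosure (v.adicCompletion F))ˣ := (Units.mk0 β hβ0)⁻¹ with hudef
  refine ⟨Ψ (Additive.ofMul u), fun τ ↦ ?_⟩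
  have hζu : ζ τ = Units.map (Field.absoluteGaloisGroup.toAlgEquiv (v.adicCompletion F) τ :
      AlgebraicClosure (v.adicCompletion F) →* AlgebraicClosure (v.adicCompletion F)) u * u⁻¹ := by
    ext
    rw [Units.val_mul, Units.coe_map, MonoidHom.coe_coe, hudef, inv_inv, Units.val_inv_eq_inv_val,
      Units.val_mk0, map_inv₀]
    have h := hβ τ
    have hβτ : (Field.absoluteGaloisGroup.toAlgEquiv (v.adicCompletion F) τ) β ≠ 0 := by
      rw [ne_eq, map_eq_zero_iff _ (AlgEquiv.injective _)]; exact hβ0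
    field_simp
    change c τ * _ = β
    exact h
  rw [← hζ τ, hζu, ofMul_mul, ofMul_inv, map_add, map_neg, ← hΨG, sub_eq_add_neg]

/-! ### Any subgroup: a Kummer coboundary up to the factor `2` of the quadratic character -/

include hker hq0 hq1 in
/-- **`2•d = ∂P` for a cocycle with values in `Ψ(μ)` on ANY subgroup `H ≤ Γ_{K_v}`** (twisted uniformisation: `t ∈ K̄_v`
with `σt = ±t` for all `σ`, `σ•Ψ(u) = χ(σ)Ψ(σu)`, `χ(σ) = 1 ⇔ σt = t`). For `d : H → E(K̄_v)` with `d(τ₁τ₂) = d τ₁ + τ₁•d τ₂`,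
OPEN zero set and values `Ψ(ζ_τ)` (`ζ_τ` of finite order) there is `P` with `2•d τ = τ•P − P` for all `τ ∈ H`: on
`H₁ = H ∩ Stab(t)` the map `Ψ` is equivariant and `d = ∂P₁` (`exists_eq_coboundary_of_values_in_roots`); `d − ∂P₁` vanishes on
`H₁`, so `2(d − ∂P₁) = ∂R` (X2 `exists_two_nsmul_eq_of_vanishing_on_stabilizer`, `[H : H₁] ≤ 2`). This is the Tate-side
substitute, up to `2`, for the Coates–Greenberg vanishing `H¹(K_{∞,η}, Ê(𝔪̄)) = 0` used at good ordinary places.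
[cite: GreenbergLNM1716, §2 pp. 75–76 and §4 p. 108] [cite: SerreLocalFields1979, Ch. VII §6, Ch. X §1 Prop. 2] -/
theorem exists_two_nsmul_eq_coboundary_of_values_in_roots {t : AlgebraicClosure (v.adicCompletion F)}
    (ht : ∀ σ : absoluteGaloisGroup (v.adicCompletion F), σ • t = t ∨ σ • t = -t)
    (hequiv : ∀ (σ : absoluteGaloisGroup (v.adicCompletion F)) (u : (AlgebraicClosure (v.adicCompletion F))ˣ),
      σ • Ψ (Additive.ofMul u) =
        (if Field.absoluteGaloisGroup.toAlgEquiv (v.adicCompletion F) σ t = t then (1 : ℤ) else -1) •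
          Ψ (Additive.ofMul (Units.map
            (Field.absoluteGaloisGroup.toAlgEquiv (v.adicCompletion F) σ :
              AlgebraicClosure (v.adicCompletion F) →* AlgebraicClosure (v.adicCompletion F)) u)))
    (H : Subgroup (absoluteGaloisGroup (v.adicCompletion F)))
    (d : H → localPoints W (v.adicCompletion F))
    (hd : ∀ τ₁ τ₂ : H, d (τ₁ * τ₂) = d τ₁ + (τ₁ : absoluteGaloisGroup (v.adicCompletion F)) • d τ₂)
    (hopen : IsOpen {τ : H | d τ = 0})
    (hC : ∀ τ : H, ∃ ζ : (AlgebraicClosure (v.adicCompletion F))ˣ, IsOfFinOrder ζ ∧ Ψ (Additive.ofMul ζ) = d τ) :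
    ∃ P : localPoints W (v.adicCompletion F), ∀ τ : H,
      2 • d τ = (τ : absoluteGaloisGroup (v.adicCompletion F)) • P - P := by
  -- notation
  let Γ := absoluteGaloisGroup (v.adicCompletion F)
  let Pt := localPoints W (v.adicCompletion F)
  -- the subgroup `H₁ = H ∩ Stab(t)`
  let H₁ : Subgroup Γ := H ⊓ MulAction.stabilizer Γ t
  have hH₁ : ∀ σ : Γ, σ ∈ H₁ ↔ σ ∈ H ∧ σ • t = t := fun σ ↦ by
    change σ ∈ H ⊓ MulAction.stabilizer Γ t ↔ _
    rw [Subgroup.mem_inf, MulAction.mem_stabilizer_iff]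
  -- `Ψ` is equivariant on `H₁`
  have hΨG : ∀ τ : H₁, ∀ u : (AlgebraicClosure (v.adicCompletion F))ˣ,
      (τ : Γ) • Ψ (Additive.ofMul u) =
        Ψ (Additive.ofMul (Units.map (Field.absoluteGaloisGroup.toAlgEquiv (v.adicCompletion F) τ :
          AlgebraicClosure (v.adicCompletion F) →* AlgebraicClosure (v.adicCompletion F)) u)) := by
    intro τ u
    have h := hequiv (τ : Γ) u
    have hτt : Field.absoluteGaloisGroup.toAlgEquiv (v.adicCompletion F) (τ : Γ) t = t := ((hH₁ _).mp τ.2).2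
    rw [if_pos hτt, one_zsmul] at h
    exact h
  -- the restriction of `d` to `H₁`
  let ι : H₁ → H := fun τ ↦ ⟨(τ : Γ), ((hH₁ _).mp τ.2).1⟩
  have hιmul : ∀ τ₁ τ₂ : H₁, ι (τ₁ * τ₂) = ι τ₁ * ι τ₂ := fun _ _ ↦ Subtype.ext rfl
  have hιcont : Continuous ι := continuous_subtype_val.subtype_mk _
  let d₁ : H₁ → Pt := fun τ ↦ d (ι τ)
  have hd₁ : ∀ τ₁ τ₂ : H₁, d₁ (τ₁ * τ₂) = d₁ τ₁ + (τ₁ : Γ) • d₁ τ₂ := fun τ₁ τ₂ ↦ by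
    change d (ι (τ₁ * τ₂)) = d (ι τ₁) + (τ₁ : Γ) • d (ι τ₂)
    rw [hιmul, hd]
  have hopen₁ : IsOpen {τ : H₁ | d₁ τ = 0} := hopen.preimage hιcont
  have hC₁ : ∀ τ : H₁, ∃ ζ : (AlgebraicClosure (v.adicCompletion F))ˣ, IsOfFinOrder ζ ∧ Ψ (Additive.ofMul ζ) = d₁ τ :=
    fun τ ↦ hC (ι τ)
  obtain ⟨P₁, hP₁⟩ := exists_eq_coboundary_of_values_in_roots W Ψ hker hq0 hq1 H₁ hΨG d₁ hd₁ hopen₁ hC₁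
  -- `e = d − ∂P₁` vanishes on `H₁`
  let e : H → Pt := fun τ ↦ d τ - ((τ : Γ) • P₁ - P₁)
  have he : ∀ τ₁ τ₂ : H, e (τ₁ * τ₂) = e τ₁ + (τ₁ : Γ) • e τ₂ := by
    intro τ₁ τ₂
    change d (τ₁ * τ₂) - (((τ₁ * τ₂ : H) : Γ) • P₁ - P₁) =
      d τ₁ - ((τ₁ : Γ) • P₁ - P₁) + (τ₁ : Γ) • (d τ₂ - ((τ₂ : Γ) • P₁ - P₁))
    rw [hd, Subgroup.coe_mul, mul_smul, smul_sub, smul_sub]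
    abel
  have ht' : ∀ τ : H, (τ : Γ) • t = t ∨ (τ : Γ) • t = -t := fun τ ↦ ht τ
  have he1 : ∀ τ : H, (τ : Γ) • t = t → e τ = 0 := by
    intro τ hτ
    have hmem : (τ : Γ) ∈ H₁ := (hH₁ _).mpr ⟨τ.2, hτ⟩
    have h := hP₁ ⟨τ, hmem⟩
    change d (ι ⟨τ, hmem⟩) = (τ : Γ) • P₁ - P₁ at h
    have hιτ : ι ⟨τ, hmem⟩ = τ := Subtype.ext rfl
    rw [hιτ] at h
    change d τ - ((τ : Γ) • P₁ - P₁) = 0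
    rw [h, sub_self]
  obtain ⟨R, hR⟩ := GreenbergVatsalTateKummerLocal.exists_two_nsmul_eq_of_vanishing_on_stabilizer (F := F) H ht' e he he1
  refine ⟨2 • P₁ + R, fun τ ↦ ?_⟩
  have h := hR τ
  change 2 • (d τ - ((τ : Γ) • P₁ - P₁)) = (τ : Γ) • R - R at h
  rw [smul_sub, sub_eq_iff_eq_add] at h
  rw [h, smul_add, smul_sub, smul_comm (τ : Γ) (2 : ℕ) P₁]
  abel

end Summit.BirchSwinnertonDyer.BirchSwinnertonDyer.Theorems.MultLocSurj

end
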